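import Literature.AlgebraicGeometry.Deformation.SmoothSchemeLiftObstructionCriterionGlueDatum
import Literature.AlgebraicGeometry.Morphisms.GlueDataOverBase
import Mathlib.AlgebraicGeometry.Morphisms.Smooth
import HarnessLib

/-!
# Gluing the lifted charts, V: the glued deformation `X' → Spec R` and its smoothness
# (Hartshorne, *Deformation Theory*, proof of Thm. 10.2 (a): «… to obtain a global deformation `X'` of `X`»)

HOME SEED (cell `hodgecm-mathlib`, F-11 (A3) F3b FILE 3; provisional path
`Deformation/SmoothSchemeLiftObstructionCriterionGluedScheme.lean`).  Theorems only; imports FILE 2 (the glue datum),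
★ `Morphisms/GlueDataOverBase` and Mathlib `Morphisms/Smooth`.

For the glue datum `𝒟 := deformationGlueDatum …` of cocycle-exact lifted gluing data (charts `Spec (R ⊗_k Γ(U j))`) and its
glued scheme `X' := 𝒟.glueData.glued` (Mathlib `Scheme.GlueData`; the charts `𝒟.glueData.ι j : Spec (R ⊗_k Γ(U j)) ⟶ X'`
are open immersions covering `X'`), THIS FILE records:

* `existsUnique_structureMap` — a UNIQUE `q : X' ⟶ Spec R` with `ι j ≫ q = Spec (r ↦ r ⊗ 1)` on every chart (★
  `glueData_existsUnique_desc`; the transition maps are over `Spec R`, FILE 1b `transition_over_base`);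
* `smooth_chart` — each chart map `Spec (R ⊗_k Γ(U j)) → Spec R` is SMOOTH when `X → Spec k` is (it is the base change
  of `U j ↪ X → Spec k` along `Spec R → Spec k`, Mathlib `pullbackSpecIso`); hence
* **`smooth_structureMap`** — `q` is smooth (smoothness is Zariski-local at the source, ★
  `glueData_desc_of_isZariskiLocalAtSource`); in particular flat and locally of finite presentation (Mathlib instances).

The reduction square along `R → R⧸J` (a morphism of glue data with cartesian charts, ★ `glueData_isPullback_ι_map`)
and the identification of the closed fibre are the sequel.
HC_CM is proved only modulo the 7 printed citations until rung 0 closes — nothing here bears on a summit statement.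

## References
* [Hartshorne2010] R. Hartshorne, *Deformation Theory*, GTM 257, Springer (2010): Thm. 10.2 (a) and its proof (p. 81),
  Cor. 4.8 (p. 30: the charts are the trivial deformations).
* [StacksProject] The Stacks Project, Tag 01JA (glueing schemes), Tag 01LH (relative glueing).
* [Hartshorne1977] R. Hartshorne, *Algebraic Geometry*, GTM 52 (1977): II Ex. 2.12, III Prop. 10.1 (smoothness under
  base change).
-/

noncomputable section

-- `TopCat.Presheaf`/`TopCat.Sheaf` are not reducible (as in Mathlib's `AlgebraicGeometry/Modules`).
set_option backward.isDefEq.respectTransparency false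

open CategoryTheory AlgebraicGeometry Opposite TopologicalSpace Limits
open scoped TensorProduct

universe u

namespace Literature.AlgebraicGeometry.Deformation

open Literature.AlgebraicGeometry.Motives Literature.AlgebraicGeometry.Morphisms

variable {k : Type u} [Field k] {X : Over (Spec (CommRingCat.of k))}
  [instΓ : ∀ W : X.left.Opens, Algebra k Γ(X.left, W)]
  (halg : ∀ (W : X.left.Opens) (s : k), algebraMap k Γ(X.left, W) s = (constToPresheaf X).app (op W) s)
  (R : Type u) [CommRing R] [Algebra k R]
  {ι : Type u} (U : ι → X.left.affineOpens) (b : (j l : ι) → Γ(X.left, (U j).1))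
  (hb : ∀ j l, (U j).1 ⊓ (U l).1 = X.left.basicOpen (b j l))
  (ψ : (j l : ι) → R ⊗[k] Γ(X.left, (U j).1 ⊓ (U l).1) ≃ₐ[R] R ⊗[k] Γ(X.left, (U j).1 ⊓ (U l).1))
  (𝔫 : Ideal R) (h𝔫 : IsNilpotent 𝔫)
  (hψ : ∀ j l x, ψ j l x - x ∈ 𝔫 • (⊤ : Submodule R (R ⊗[k] Γ(X.left, (U j).1 ⊓ (U l).1))))
  (hcoc : ∀ (j l m : ι)
    (Φjl : R ⊗[k] Γ(X.left, (U j).1 ⊓ (U l).1) →ₐ[R] R ⊗[k] Γ(X.left, (U j).1 ⊓ (U l).1 ⊓ (U m).1))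
    (_ : ∀ a s, Φjl (a ⊗ₜ s) = a ⊗ₜ X.left.presheaf.map (homOfLE inf_le_left).op s)
    (Φlm : R ⊗[k] Γ(X.left, (U l).1 ⊓ (U m).1) →ₐ[R] R ⊗[k] Γ(X.left, (U j).1 ⊓ (U l).1 ⊓ (U m).1))
    (_ : ∀ a s, Φlm (a ⊗ₜ s) = a ⊗ₜ X.left.presheaf.map
      (homOfLE (le_inf (inf_le_left.trans inf_le_right) inf_le_right)).op s)
    (Φjm : R ⊗[k] Γ(X.left, (U j).1 ⊓ (U m).1) →ₐ[R] R ⊗[k] Γ(X.left, (U j).1 ⊓ (U l).1 ⊓ (U m).1))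
    (_ : ∀ a s, Φjm (a ⊗ₜ s) = a ⊗ₜ X.left.presheaf.map
      (homOfLE (le_inf (inf_le_left.trans inf_le_left) inf_le_right)).op s)
    (ρjl ρlm ρjm : R ⊗[k] Γ(X.left, (U j).1 ⊓ (U l).1 ⊓ (U m).1) ≃ₐ[R]
      R ⊗[k] Γ(X.left, (U j).1 ⊓ (U l).1 ⊓ (U m).1)),
    (∀ x, ρjl (Φjl x) = Φjl (ψ j l x)) → (∀ x, ρlm (Φlm x) = Φlm (ψ l m x)) →
    (∀ x, ρjm (Φjm x) = Φjm (ψ j m x)) → ρlm * ρjl = ρjm)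

/-! ## §1 The structure morphism `X' → Spec R` -/

include hb h𝔫 hψ in
/-- **The glued deformation is a scheme over `Spec R`**: there is a unique `q : X' ⟶ Spec R` restricting on every chart
`Spec (R ⊗_k Γ(U j))` to `Spec (r ↦ r ⊗ 1)` (the transition maps are over `Spec R`).
[cite: StacksProject, Tag 01JA] [cite: Hartshorne2010, Thm. 10.2 (proof), p. 81] -/
theorem existsUnique_structureMap :
    ∃! q : (deformationGlueDatum halg R U b hb ψ 𝔫 h𝔫 hψ hcoc).glueData.glued ⟶ Spec (CommRingCat.of R),
      ∀ j, (deformationGlueDatum halg R U b hb ψ 𝔫 h𝔫 hψ hcoc).glueData.ι j ≫ q =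
        Spec.map (CommRingCat.ofHom (Algebra.TensorProduct.includeLeftRingHom
          (R := k) (A := R) (B := Γ(X.left, (U j).1)))) := by
  refine glueData_existsUnique_desc (deformationGlueDatum halg R U b hb ψ 𝔫 h𝔫 hψ hcoc).glueData
    (fun j => Spec.map (CommRingCat.ofHom
      (Algebra.TensorProduct.includeLeftRingHom (R := k) (A := R) (B := Γ(X.left, (U j).1))))) fun i j => ?_
  rw [OpensGlueDatum.glueData_f, OpensGlueDatum.glueData_f, OpensGlueDatum.glueData_t, ← Category.assoc,
    OpensGlueDatum.tLift_ι]
  change (chartOverlap R U i j).ι ≫ _ = transitionMap halg R U ψ i j ≫ _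
  rw [transitionMap_eq]
  exact (transition_over_base (overlapRingHom_tmul_one halg R U i j) (ψ i j) (baseChangeRight_tmul halg R U i j)).symm

/-! ## §2 Smoothness -/

include halg in
/-- The structure map `k → Γ(U)` of an open of the `k`-scheme `X`, as a morphism: `algebraMap k Γ(U) = ΓSpecIso⁻¹ ≫ X.hom^*|_U`.
[cite: Hartshorne1977, II.8 p. 172 (the `k`-structure of `𝒪_X`)] -/
theorem ofHom_algebraMap_eq (V : X.left.Opens) :
    CommRingCat.ofHom (algebraMap k Γ(X.left, V)) = (Scheme.ΓSpecIso (CommRingCat.of k)).inv ≫ X.hom.appLE ⊤ V le_top := by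
  apply CommRingCat.hom_ext
  refine RingHom.ext fun s => ?_
  exact halg V s

include halg in
/-- **`Spec Γ(U) → Spec k` is smooth for an affine open `U` of a smooth `k`-scheme** (it is `U ↪ X → Spec k` up to the
isomorphism `Spec Γ(Spec k, ⊤) ≅ Spec k`). [cite: Hartshorne1977, III Prop. 10.1] -/
theorem smooth_SpecMap_algebraMap [Smooth X.hom] {V : X.left.Opens} (hV : IsAffineOpen V) :
    Smooth (Spec.map (CommRingCat.ofHom (algebraMap k Γ(X.left, V)))) := by
  have e : Spec.map (X.hom.appLE ⊤ V le_top) = (hV.fromSpec ≫ X.hom) ≫ (Spec (CommRingCat.of k)).isoSpec.hom := by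
    rw [← IsAffineOpen.SpecMap_appLE_fromSpec X.hom (isAffineOpen_top _) hV le_top, IsAffineOpen.fromSpec_top,
      Category.assoc, Iso.inv_hom_id, Category.comp_id]
  have h1 : Smooth (Spec.map (X.hom.appLE ⊤ V le_top)) := by
    rw [e]
    infer_instance
  rw [ofHom_algebraMap_eq halg V, Spec.map_comp]
  infer_instance

include halg in
/-- **The chart maps `Spec (R ⊗_k Γ(U)) → Spec R` are smooth** for an affine open `U` of a smooth `k`-scheme (base change of
`Spec Γ(U) → Spec k` along `Spec R → Spec k`, Mathlib `pullbackSpecIso`). [cite: Hartshorne1977, III Prop. 10.1 (b)] -/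
theorem smooth_chart [Smooth X.hom] {V : X.left.Opens} (hV : IsAffineOpen V) :
    Smooth (Spec.map (CommRingCat.ofHom (Algebra.TensorProduct.includeLeftRingHom
      (R := k) (A := R) (B := Γ(X.left, V))))) := by
  haveI := smooth_SpecMap_algebraMap halg hV
  rw [← pullbackSpecIso_inv_fst k R Γ(X.left, V)]
  infer_instance

include halg in
/-- **The glued deformation `X' → Spec R` is SMOOTH** when `X → Spec k` is (smoothness is Zariski-local at the source
and the charts are smooth). In particular it is flat and locally of finite presentation.
[cite: Hartshorne2010, Thm. 10.2 (proof), p. 81] [cite: Hartshorne1977, III Prop. 10.1] -/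
theorem smooth_structureMap [Smooth X.hom]
    (q : (deformationGlueDatum halg R U b hb ψ 𝔫 h𝔫 hψ hcoc).glueData.glued ⟶ Spec (CommRingCat.of R))
    (hq : ∀ j, (deformationGlueDatum halg R U b hb ψ 𝔫 h𝔫 hψ hcoc).glueData.ι j ≫ q =
      Spec.map (CommRingCat.ofHom (Algebra.TensorProduct.includeLeftRingHom
        (R := k) (A := R) (B := Γ(X.left, (U j).1))))) : Smooth q :=
  glueData_desc_of_isZariskiLocalAtSource _ @Smooth _ q hq fun j => smooth_chart halg R (U j).2

end Literature.AlgebraicGeometry.Deformation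

end
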